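import Summits.ResolutionOfSingularities.ResolutionOfSingularities.Theorems.LossEpisode2
import HarnessLib

/-!
# LossEpisode3 — the loss episode automaton, slice 3 (§8 regimes of the ledger: light run states are fatal, the tail is
heavy; §9 the lossy-tail form of the located residual)

decomp-res-lens-3, gen 28 (session 2); imports slice 2 `Theorems.LossEpisode2` (§5–§7).  See the module docstring of
slice 1 `Theorems.LossEpisode`.

WHAT THIS SLICE ADDS (all PROVED, hypothesis-free beyond the common tail block `TailHyp`; standard axioms):

* §8 `light_fatal` — a run state whose loss wall `u_j^m` AND run wall `u_i^k` are both LIGHT (`m + s < q`, `k + s < q`) cannot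
  occur on the tail (pure ledger descent on the carrier: no loss can leave it, every arrow lowers `k + m`);
  `runState_next_heavy` — the arrows R / X1 / X2 preserve heaviness of the loss wall (`q ≤ m + s`); `tail_sorts_heavy` — after a
  total loss every later run stage of the tail has a HEAVY loss wall.  CONSEQUENCE: hypothesis (a) of [CJS, Thm. 233]
  («no equimultiple curve through the point») holds AUTOMATICALLY at every run state of a lossy tail in the form needed by the
  polygon engine — `q ≤ s + r a` for the loss-wall letter `a`, whence `α < 1` (`LossPolygon3.alphaOf_polyPts_lt_one`) and every
  R-arrow is β-STRICT (`LossPolygon3.betaOf_polyPts_succ_chart_snd_lt`).  The «light regime» risk (r2) of NODE-g28 §4 is void.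
* §9 `exists_runState_after_loss` — after a total loss on the tail there IS a (heavy) run state later on the tail (the chain of
  consecutive losses has strictly decreasing masses); `NoRunStateOnLossyTail` — the automaton form WITH the residual's own
  loss-recurrence binder («total losses infinitely often») and heaviness, so that the episode measure never has to treat an
  infinite loss-free episode; `noLossyStrictTailsDeep_of_noRunStateOnLossyTail : NoRunStateOnLossyTail → NoLossyStrictTailsDeep`
  and `noRunStateOnLossyTail_of_noRunStateOnTail` (PROVED).

References: [CJS] V. Cossart, U. Jannsen, S. Saito, arXiv:0905.2191, §13 (Thm. 233, hypothesis (a); Lemma 230).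
-/

open MvPolynomial Finset
open Literature.AlgebraicGeometry.Resolution
open Literature.AlgebraicGeometry.Resolution.Hauser2010
open Literature.AlgebraicGeometry.Resolution.PointBlowup
open Summit.ResolutionOfSingularities.ResolutionOfSingularities.Theorems.TightDefectClasses
open Summit.ResolutionOfSingularities.ResolutionOfSingularities.Theorems.TightDefectStrongWalks
open Summit.ResolutionOfSingularities.ResolutionOfSingularities.Theorems.ItineraryCutClasses
open Summit.ResolutionOfSingularities.ResolutionOfSingularities.Theorems.BoundaryLedger
open Summit.ResolutionOfSingularities.ResolutionOfSingularities.Theorems.ProximityCut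
open Summit.ResolutionOfSingularities.ResolutionOfSingularities.Theorems.ConeCut
open Summit.ResolutionOfSingularities.ResolutionOfSingularities.Theorems.WallCut
open Summit.ResolutionOfSingularities.ResolutionOfSingularities.Theorems.WallCutCritical
open Summit.ResolutionOfSingularities.ResolutionOfSingularities.Theorems.LossIsFatal
open Summit.ResolutionOfSingularities.ResolutionOfSingularities.Theorems.LossIsFatalLayer
open Summit.ResolutionOfSingularities.ResolutionOfSingularities.Theorems.LossIsFatalLedger
open Summit.ResolutionOfSingularities.ResolutionOfSingularities.Theorems.LossExitCone

namespace Summit.ResolutionOfSingularities.ResolutionOfSingularities.Theorems.LossEpisode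

variable {K : Type} [Field K] [DecidableEq K] {q : ℕ} {s₀ : State (Fin 3) K}

/-! ## §8 Regimes of the ledger: light run states are fatal, the tail is heavy -/

section Regime

variable {W : ForcedWalk q s₀} {N s : ℕ}

/-- **LIGHT RUN STATES ARE FATAL (PROVED).**  Call the loss wall `u_j^m` of a run state HEAVY when `q ≤ m + s` and LIGHT when
`m + s < q`; likewise for the run wall `u_i^k`.  A run state on the tail with BOTH walls light cannot exist: no total loss can
leave it (`lossMove_next` needs `q < T + s` for the lost mass `T = k + m + s − q`, i.e. `2q < k + m + 2s`), and each of the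
arrows R / X1 / X2 of `runState_next` leads to a run state with both walls light again and strictly smaller total mass `k + m`
(R: `k ↦ k + m + s − q < k`; X1, X2: `m ↦ k + m + s − q < m`) — strong induction on `k + m`.  Pure ledger arithmetic on the
carrier; no polygon. [new] -/
theorem light_fatal (hroot : IsRoot q s₀) (hT : TailHyp W N s) :
    ∀ (n u : ℕ) (i j l : Fin 3) (k m : ℕ), k + m = n → N ≤ u → IsRunState W s u i j l k m →
      m + s < q → k + s < q → False := by
  intro n
  induction n using Nat.strong_induction_on with
  | _ n ih =>
    intro u i j l k m hn hNu hS hm hk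
    obtain ⟨hq, -, -, hnext⟩ := runState_next hroot hT hNu hS
    rcases hnext with ⟨-, -, hS'⟩ | ⟨-, -, hS'⟩ | ⟨-, -, -, hS'⟩ | ⟨-, hL, -⟩
    · exact ih _ (by omega) (u + 1) i j l (k + m + s - q) m rfl (by omega) hS' hm (by omega)
    · exact ih _ (by omega) (u + 1) i j l k (k + m + s - q) rfl (by omega) hS' (by omega) hk
    · exact ih _ (by omega) (u + 1) i l j k (k + m + s - q) rfl (by omega) hS' (by omega) hk
    · obtain ⟨T, hoT, -, -, hqT, -⟩ := lossMove_next hroot hT hNu hL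
      obtain ⟨ho, -, -, -, -⟩ := runState_ledger hroot hT hNu hS
      have h := ENat.coe_inj.mp (ho.symm.trans hoT)
      omega

/-- **THE ARROWS PRESERVE HEAVINESS (PROVED).**  From a run state on the tail whose loss wall is heavy (`q ≤ m + s`) the next
stage is: the R-arrow to a run state with the same (heavy) loss wall; an X1- or X2-arrow to a run state whose NEW loss wall
`k + m + s − q` is heavy again — for an X-arrow onto a light loss wall forces the kept run wall to be light as well
(`(m + s − q) + (k + s − q) < 0` with the first summand `≥ 0`), which is fatal by `light_fatal`; or a total loss.  [new] -/
theorem runState_next_heavy (hroot : IsRoot q s₀) (hT : TailHyp W N s) {u : ℕ} (hNu : N ≤ u) {i j l : Fin 3} {k m : ℕ}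
    (hS : IsRunState W s u i j l k m) (hm : q ≤ m + s) :
    q < k + m + s ∧ k + 1 ≤ s ∧ m + 1 ≤ s ∧
    ( (W.j u = i ∧ W.b u = 0 ∧ IsRunState W s (u + 1) i j l (k + m + s - q) m) ∨
      (W.j u = j ∧ W.b u i = 0 ∧ q ≤ (k + m + s - q) + s ∧ IsRunState W s (u + 1) i j l k (k + m + s - q)) ∨
      (W.j u = l ∧ W.b u i = 0 ∧ W.b u j ≠ 0 ∧ q ≤ (k + m + s - q) + s ∧
          IsRunState W s (u + 1) i l j k (k + m + s - q)) ∨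
      (((W.j u = i ∧ W.b u j ≠ 0) ∨ (W.j u = j ∧ W.b u i ≠ 0) ∨ (W.j u = l ∧ W.b u i ≠ 0 ∧ W.b u j ≠ 0)) ∧
        IsLossMove W u ∧ (W.st (u + 1)).r = Finsupp.single (W.j u) (k + m + s - q)) ) := by
  obtain ⟨hq, hks, hms, hnext⟩ := runState_next hroot hT hNu hS
  refine ⟨hq, hks, hms, ?_⟩
  rcases hnext with hR | ⟨hju, hbi, hS'⟩ | ⟨hju, hbi, hbj, hS'⟩ | hL
  · exact Or.inl hR
  · by_cases h : q ≤ (k + m + s - q) + s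
    · exact Or.inr (Or.inl ⟨hju, hbi, h, hS'⟩)
    · exact (light_fatal hroot hT _ (u + 1) i j l k (k + m + s - q) rfl (by omega) hS' (by omega) (by omega)).elim
  · by_cases h : q ≤ (k + m + s - q) + s
    · exact Or.inr (Or.inr (Or.inl ⟨hju, hbi, hbj, h, hS'⟩))
    · exact (light_fatal hroot hT _ (u + 1) i l j k (k + m + s - q) rfl (by omega) hS' (by omega) (by omega)).elim
  · exact Or.inr (Or.inr (Or.inr hL))

/-- **THE TAIL IS HEAVY (PROVED)** — `tail_sorts` with the regime recorded: after a total loss at `t ≥ N`, every later RUN stage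
has a heavy loss wall, `q ≤ m + s` (entry states are heavy by `runState_of_stays_loss`: `T + s = q + d`, `1 ≤ d`; the arrows
preserve heaviness by `runState_next_heavy`).  CONSEQUENCE for the episode measure: at every run state of the tail the
hypothesis of `LossPolygon3.alphaOf_polyPts_lt_one` / `betaOf_polyPts_succ_chart_snd_lt` (`q ≤ s + r a`, `a` = loss-wall
letter) holds — CJS's hypothesis (a) of [CJS, Thm. 233] in the form `α < 1` is AUTOMATIC on a lossy tail, and every R-arrow
is β-strict. [new] -/
theorem tail_sorts_heavy (hroot : IsRoot q s₀) (hT : TailHyp W N s) {t : ℕ} (hNt : N ≤ t) (hloss : IsLossMove W t)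
    (n : ℕ) :
    IsLossMove W (t + n) ∨
      (∃ t' : ℕ, t' + 1 = t + n ∧ N ≤ t' ∧ IsLossMove W t' ∧ StaysOnNewest W t') ∨
      (∃ i j l : Fin 3, ∃ k m : ℕ, q ≤ m + s ∧ IsRunState W s (t + n) i j l k m) := by
  induction n with
  | zero => exact Or.inl (by simpa using hloss)
  | succ n ih =>
    rcases ih with hL | ⟨t', ht', hNt', hL', hst'⟩ | ⟨i, j, l, k, m, hm, hS⟩
    · obtain ⟨T, -, -, -, -, hnext⟩ := lossMove_next hroot hT (by omega) hL
      rcases hnext with ⟨-, hL1, -⟩ | ⟨hst, -⟩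
      · exact Or.inl (by rw [← add_assoc]; exact hL1)
      · exact Or.inr (Or.inl ⟨t + n, by omega, by omega, hL, hst⟩)
    · obtain ⟨l, T, d, -, -, -, -, hTd, h1d, hS⟩ := runState_of_stays_loss hroot hT hNt' hL' hst'
      refine Or.inr (Or.inr ⟨W.j (t' + 1), W.j t', l, d, T, by omega, ?_⟩)
      have h : t' + 2 = t + (n + 1) := by omega
      rw [← h]; exact hS
    · obtain ⟨-, -, -, hnext⟩ := runState_next_heavy hroot hT (by omega) hS hm
      rcases hnext with ⟨-, -, hS'⟩ | ⟨-, -, hm', hS'⟩ | ⟨-, -, -, hm', hS'⟩ | ⟨-, hL, -⟩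
      · exact Or.inr (Or.inr ⟨i, j, l, _, _, hm, by rw [← add_assoc]; exact hS'⟩)
      · exact Or.inr (Or.inr ⟨i, j, l, _, _, hm', by rw [← add_assoc]; exact hS'⟩)
      · exact Or.inr (Or.inr ⟨i, l, j, _, _, hm', by rw [← add_assoc]; exact hS'⟩)
      · obtain ⟨T, -, -, -, -, hnext'⟩ := lossMove_next hroot hT (by omega) hL
        rcases hnext' with ⟨-, hL1, -⟩ | ⟨hst, -⟩
        · exact Or.inl (by rw [← add_assoc]; exact hL1)
        · exact Or.inr (Or.inl ⟨t + n, by omega, by omega, hL, hst⟩)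

end Regime

/-! ## §9 The lossy-tail form of the located residual -/

section LossyTail

variable {W : ForcedWalk q s₀} {N s : ℕ}

/-- After a total loss at `t ≥ N` whose lost mass is `T` there is a later run stage of the tail with a HEAVY loss wall
(strong induction on `T`: a consecutive loss has mass `T + s − q < T`; a proximity repeat yields a run state at `t + 2`
with loss wall `T`, `T + s = q + d ≥ q + 1`). [new] -/
theorem exists_runState_after_loss_aux (hroot : IsRoot q s₀) (hT : TailHyp W N s) :
    ∀ (T t : ℕ), N ≤ t → IsLossMove W t → (W.st (t + 1)).r = Finsupp.single (W.j t) T →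
      ∃ u : ℕ, N ≤ u ∧ ∃ i j l : Fin 3, ∃ k m : ℕ, q ≤ m + s ∧ IsRunState W s u i j l k m := by
  intro T
  induction T using Nat.strong_induction_on with
  | _ T ih =>
    intro t hNt hloss hr
    obtain ⟨T', -, -, hr', hqT, hnext⟩ := lossMove_next hroot hT hNt hloss
    have hTT : T' = T := Finsupp.single_injective (W.j t) (hr'.symm.trans hr)
    subst hTT
    rcases hnext with ⟨-, hloss1, hr1⟩ | ⟨-, l, d, -, -, hTd, h1d, hS⟩
    · have hslt := hT.s_lt
      exact ih (T' + s - q) (by omega) (t + 1) (by omega) hloss1 hr1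
    · exact ⟨t + 2, by omega, W.j (t + 1), W.j t, l, d, T', by omega, hS⟩

/-- **AFTER A TOTAL LOSS ON THE TAIL THERE IS A HEAVY RUN STATE ON THE TAIL (PROVED).** [new] -/
theorem exists_runState_after_loss (hroot : IsRoot q s₀) (hT : TailHyp W N s) {t : ℕ} (hNt : N ≤ t)
    (hloss : IsLossMove W t) :
    ∃ u : ℕ, N ≤ u ∧ ∃ i j l : Fin 3, ∃ k m : ℕ, q ≤ m + s ∧ IsRunState W s u i j l k m := by
  obtain ⟨T, -, -, hr, -, -⟩ := lossMove_next hroot hT hNt hloss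
  exact exists_runState_after_loss_aux hroot hT T t hNt hloss hr

end LossyTail

/-- **NO HEAVY RUN STATE ON A LOSSY TAIL** — the automaton form of the located residual WITH the residual's own recurrence
binders: translated infinitely often, every letter met infinitely often, and TOTAL LOSSES INFINITELY OFTEN (the last binder of
`WallCut.NoLossyStrictTailsDeep`), restricted to run states with a HEAVY loss wall (`q ≤ m + s`, automatic by §8).  This is
the statement on which the episode measure is to be proved: because losses recur, every episode is finite and the measure
only has to descend from one entry state to the next (no infinite loss-free episode, no ζ). OPEN. [new] -/
def NoRunStateOnLossyTail : Prop :=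
  ∀ p : ℕ, p.Prime → ∀ e : ℕ, 2 ≤ e → ∀ (K : Type) [Field K] [CharP K p] [PerfectField K] [DecidableEq K]
    (s₀ : State (Fin 3) K), IsRoot (p ^ e) s₀ → ∀ W : ForcedWalk (p ^ e) s₀, ∀ N s : ℕ, TailHyp W N s →
    (∀ M : ℕ, ∃ t, M ≤ t ∧ W.b t ≠ 0) → (∀ (k : Fin 3) (N' : ℕ), ∃ t, N' ≤ t ∧ (W.j t = k ∨ W.b t k ≠ 0)) →
    (∀ M : ℕ, ∃ t, M ≤ t ∧ IsLossMove W t) →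
    ∀ u : ℕ, N ≤ u → ∀ (i j l : Fin 3) (k m : ℕ), p ^ e ≤ m + s → IsRunState W s u i j l k m → False

/-- The lossy-tail form is WEAKER than (implied by) `NoRunStateOnTail`. [new] [folklore] -/
theorem noRunStateOnLossyTail_of_noRunStateOnTail (h : NoRunStateOnTail) : NoRunStateOnLossyTail := by
  intro p hp e he K _ _ _ _ s₀ hroot W N s hT hb hcoord _ u hNu i j l k m _ hS
  exact h p hp e he K s₀ hroot W N s hT hb hcoord u hNu i j l k m hS

/-- **… and still implies the located residual (PROVED):** on a lossy strict tail pick a total loss at some `t ≥ N` (the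
recurrence binder), follow the chain of losses to a heavy run state (`exists_runState_after_loss`), contradiction.
[new] [folklore] -/
theorem noLossyStrictTailsDeep_of_noRunStateOnLossyTail (h : NoRunStateOnLossyTail) : NoLossyStrictTailsDeep := by
  refine noLossyStrictTailsDeep_of_subcritical ?_
  intro p hp e he K _ _ _ _ s₀ hroot W hpos N hplat hne hS hb s hsN h3 h33 h22 hlt hcoord hsd hlossy
  have hT : TailHyp W N s := tailHyp_of_binders W hplat hne hsN h3 hlt (fun t ht => (hsd t ht).1)
  obtain ⟨t, hNt, hloss⟩ := hlossy N
  obtain ⟨u, hNu, i, j, l, k, m, hm, hRS⟩ := exists_runState_after_loss hroot hT hNt hloss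
  exact h p hp e he K s₀ hroot W N s hT hb hcoord (fun M => hlossy M) u hNu i j l k m hm hRS

end Summit.ResolutionOfSingularities.ResolutionOfSingularities.Theorems.LossEpisode
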